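import Mathlib
import Literature.AlgebraicGeometry.Resolution.PlaneGermBlowup
import Literature.AlgebraicGeometry.Resolution.FormalCoordinateChange
import Literature.RingTheory.MvPowerSeries.FrobeniusPowerBasis
import Literature.RingTheory.TwoVariableSeries.Basic
import Summits.ResolutionOfSingularities.ResolutionOfSingularities.Theorems.WeightedInvariantLocalWeightedDropWildPurePowerFlagDefs

/-!
# `WeightedInvariant.LocalWeightedDrop`, line `hasse-ridge-face-selection`, piece S3πM: the two printed STATEMENTS on the game-side flag
# invariant (Hauser–Perlega Prop. 3 / Prop. 4 shapes), cleaning lemmas, and the legal triangular moves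

Crux item stmt-ResolutionOfSingularities-8899 `LocalWeightedDrop` (route `ResolutionOfSingularities/WeightedInvariant`), serving the
door `WeightedConstruction` stmt-ResolutionOfSingularities-0571.  [OURS · L1 W4.3, chain w43, stub worker 1 (gen 3).  Not a statement
of any manuscript.]

This file states the two printed propositions that the ASSEMBLY (`…WildPurePowerFlagAssembly`) turns into the descent datum of
`WildPurePower.purePower_won_of_descent₃` for the measure `PurePowerFlag.measure`, and proves the bookkeeping the strategy needs:

* `AttainStatement p e k` — [Hauser–Perlega, PRIMS 60 (2024), Prop. 3 p. 791]: at a clean position that is not terminal up to a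
  triangular change, the set of flag triples has a GREATEST element, with finite `s`;
* `DropStatement p e k` — [loc. cit., Prop. 4 p. 793]: along the normalised point-blow-up successor `x^q · T = B(x, x(t + y))`
  (`PlaneGerm.dirChart t`; for `t ≠ 0` the old letter `y` is exceptional only if `x` is — the strategy reads a translated point in
  the chart of the exceptional letter when there is exactly one), every flag triple of the cleaned successor with its new boundary
  `succE t E` is STRICTLY dominated by a flag triple of the parent.

Bookkeeping: `succE` (the successor boundary), `cleanSeries_cleanSeries`, `cleanSeries_add_pow` (cleaning kills `q`-th powers),
`exists_add_pow_eq_cleanSeries` (over a perfect field cleaning IS a re-centring `A + φ^q`), `order_le_order_cleanSeries`,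
`cleanSeries_ne_zero`, `order_le_order_subst`; the triangular changes `shift h` and `shiftSwap h` (swap, then shift) are legal moves
(`linMat_shift_det = 1`, `linMat_shiftSwap_det = −1`) and `expansion_orient_eq`: the expansion along a flag of either orientation is
the cleaning of ONE legal plane change applied to the raw coefficient.
-/

set_option linter.dupNamespace false -- mandated namespace of this single-conjunct summit

namespace Summit.ResolutionOfSingularities.ResolutionOfSingularities.Theorems

open Literature.AlgebraicGeometry.Resolution
open Literature.AlgebraicGeometry.Resolution.HauserPerlega2024

namespace PurePowerFlag

open MvPowerSeries

variable {k : Type} [Field k]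

/-! ### The successor boundary and the two printed statements -/

open Classical in
/-- The exceptional letters of the normalised successor at the point of slope `t`: the new exceptional curve is `V(x)` (letter `0`);
the old curve `V(y)` survives iff the point is its point `t = 0` and it was exceptional. [HP24 §4 p. 779: "E'_{a'} = V(xy) if t = 0
and V(y) ⊆ E_a, V(x) if t ≠ 0 or V(y) ⊄ E_a"] -/
noncomputable def succE (t : k) (E : Finset (Fin 2)) : Finset (Fin 2) :=
  if t = 0 ∧ (1 : Fin 2) ∈ E then {0, 1} else {0}

/-- [HP24, Prop. 3] ON THE GAME-SIDE FLAG INVARIANT: at a clean position (`ord > q`, `q = p^e`) which is not terminal up to a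
triangular change, the flag triples have a greatest element, and its `s`-component is finite. -/
def AttainStatement (p e : ℕ) (k : Type) [Field k] : Prop :=
  ∀ (B : MvPowerSeries (Fin 2) k) (E : Finset (Fin 2)), cleanSeries (p ^ e) B = B → B ≠ 0 →
    ((p ^ e : ℕ) : ℕ∞) < B.order → ¬ TermSub (p ^ e) B →
    ∃ v : Triple, IsFlagTriple (p ^ e) B E v ∧ (ofLex (ofLex v).2).2 ≠ ⊤ ∧ ∀ w, IsFlagTriple (p ^ e) B E w → w ≤ v

/-- [HP24, Prop. 4] ON THE GAME-SIDE FLAG INVARIANT, for the normalised successor `x^q · T = B(x, x(t+y))` of a clean non-terminal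
position (boundary rule: for `t ≠ 0`, `y` exceptional only together with `x`): if the cleaned successor is again a position and not
terminal up to a triangular change, each of its flag triples is strictly dominated by a flag triple of the parent. -/
def DropStatement (p e : ℕ) (k : Type) [Field k] : Prop :=
  ∀ (B : MvPowerSeries (Fin 2) k) (E : Finset (Fin 2)) (t : k) (T : MvPowerSeries (Fin 2) k),
    cleanSeries (p ^ e) B = B → B ≠ 0 → ((p ^ e : ℕ) : ℕ∞) < B.order → ¬ TermSub (p ^ e) B →
    (t ≠ 0 → (1 : Fin 2) ∈ E → (0 : Fin 2) ∈ E) →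
    X 0 ^ (p ^ e) * T = subst (PlaneGerm.dirChart t) B →
    ((p ^ e : ℕ) : ℕ∞) < (cleanSeries (p ^ e) T).order → ¬ TermSub (p ^ e) (cleanSeries (p ^ e) T) →
    ∀ w, IsFlagTriple (p ^ e) (cleanSeries (p ^ e) T) (succE t E) w → ∃ v, IsFlagTriple (p ^ e) B E v ∧ w < v

/-! ### Cleaning lemmas -/

open Classical in
/-- Cleaning is idempotent. -/
theorem cleanSeries_cleanSeries (q : ℕ) (A : MvPowerSeries (Fin 2) k) :
    cleanSeries q (cleanSeries q A) = cleanSeries q A := by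
  ext d
  rw [coeff_cleanSeries, coeff_cleanSeries]
  split_ifs <;> rfl

/-- A `q`-th power (`q = p^e`, characteristic `p`) has no coefficient off `q·ℕ²`. -/
theorem coeff_pow_eq_zero_of_not_dvd (p : ℕ) [Fact p.Prime] [CharP k p] (e : ℕ) (φ : MvPowerSeries (Fin 2) k)
    {d : Fin 2 →₀ ℕ} {i : Fin 2} (hd : ¬ p ^ e ∣ d i) : coeff d (φ ^ (p ^ e)) = 0 := by
  rw [← map_iterateFrobenius_expand p (Fact.out : p.Prime).ne_zero φ e, coeff_map, coeff_expand_of_not_dvd _ _ _ hd, map_zero]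

open Classical in
/-- Cleaning kills `q`-th powers: `cleanSeries q (A + φ^q) = cleanSeries q A`. -/
theorem cleanSeries_add_pow (p : ℕ) [Fact p.Prime] [CharP k p] (e : ℕ) (A φ : MvPowerSeries (Fin 2) k) :
    cleanSeries (p ^ e) (A + φ ^ (p ^ e)) = cleanSeries (p ^ e) A := by
  ext d
  rw [coeff_cleanSeries, coeff_cleanSeries]
  split_ifs with h
  · rfl
  · push Not at h
    obtain ⟨i, hi⟩ := h
    rw [map_add, coeff_pow_eq_zero_of_not_dvd p e φ hi, add_zero]

open Classical in
/-- Over a perfect field of characteristic `p`, CLEANING IS A RE-CENTRING: `A + φ^q = cleanSeries q A` for some `φ` with `φ(0) = 0`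
(provided `A(0) = 0`). [HP24 §2 p. 774: "z₁ = z − g(x,y) … we may assume that no p^e-th powers appear"] -/
theorem exists_add_pow_eq_cleanSeries (p : ℕ) [Fact p.Prime] [CharP k p] [PerfectRing k p] (e : ℕ)
    (A : MvPowerSeries (Fin 2) k) (hA : constantCoeff A = 0) :
    ∃ φ : MvPowerSeries (Fin 2) k, constantCoeff φ = 0 ∧ A + φ ^ (p ^ e) = cleanSeries (p ^ e) A := by
  haveI : ExpChar k p := ExpChar.prime Fact.out
  have hsupp : Literature.RingTheory.MvPowerSeries.IsSupportedOnMultiples (p ^ e) (cleanSeries (p ^ e) A - A) := by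
    intro m hm
    obtain ⟨i, hi⟩ := hm
    rw [map_sub, coeff_cleanSeries, if_neg (fun h => hi (h i)), sub_self]
  obtain ⟨φ, hφ⟩ := Literature.RingTheory.MvPowerSeries.exists_pow_eq_of_isSupportedOnMultiples p hsupp
  refine ⟨φ, ?_, by rw [hφ]; ring⟩
  have hc : constantCoeff (cleanSeries (p ^ e) A) = 0 := by
    rw [← coeff_zero_eq_constantCoeff_apply, coeff_cleanSeries, if_pos (fun i => by simp)]
  have h0 := congrArg constantCoeff hφ
  rw [map_pow, map_sub, hA, sub_zero, hc] at h0
  exact pow_eq_zero_iff (pow_ne_zero e (Fact.out : p.Prime).ne_zero) |>.mp h0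

open Classical in
/-- Cleaning does not lower the order. -/
theorem order_le_order_cleanSeries (q : ℕ) (A : MvPowerSeries (Fin 2) k) : A.order ≤ (cleanSeries q A).order := by
  refine MvPowerSeries.le_order fun d hd => ?_
  rw [coeff_cleanSeries]
  split_ifs
  · rfl
  · exact coeff_of_lt_order hd

open Classical in
/-- A position that is not a `q`-th power has a non-zero cleaning. -/
theorem cleanSeries_ne_zero (p : ℕ) [Fact p.Prime] [CharP k p] [PerfectRing k p] (e : ℕ) (A : MvPowerSeries (Fin 2) k)
    (hA : constantCoeff A = 0) (hnq : ∀ χ : MvPowerSeries (Fin 2) k, constantCoeff χ = 0 → A ≠ χ ^ (p ^ e)) :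
    cleanSeries (p ^ e) A ≠ 0 := by
  intro h0
  obtain ⟨φ, hφ0, hφ⟩ := exists_add_pow_eq_cleanSeries p e A hA
  rw [h0, add_eq_zero_iff_eq_neg] at hφ
  haveI : CharP (MvPowerSeries (Fin 2) k) p := Literature.RingTheory.TwoVariableSeries.charP_mvPowerSeries (Fin 2) p
  refine hnq (-φ) (by rw [map_neg, hφ0, neg_zero]) ?_
  rw [neg_pow, neg_one_pow_char_pow (MvPowerSeries (Fin 2) k) p e, neg_one_mul, hφ]

/-- A substitution by series with zero constant terms does not lower the order. -/
theorem order_le_order_subst {σ : Type*} [Fintype σ] (θ : σ → MvPowerSeries (Fin 2) k)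
    (hθ : ∀ i, constantCoeff (θ i) = 0) (A : MvPowerSeries σ k) : A.order ≤ (subst θ A).order := by
  have ha : HasSubst θ := hasSubst_of_constantCoeff_zero hθ
  refine le_trans ?_ (le_order_subst ha A)
  have h1 : (1 : ℕ∞) ≤ ⨅ i, (θ i).order :=
    le_iInf fun i => one_le_order_iff_constCoeff_eq_zero.mpr (hθ i)
  calc A.order = 1 * A.order := (one_mul _).symm
    _ ≤ (⨅ i, (θ i).order) * A.order := mul_le_mul_left h1 _

/-! ### The triangular changes are legal moves -/

/-- The coefficient of `y` in `h(x)` vanishes. -/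
theorem coeff_single_one_subst_X_zero (h : PowerSeries k) :
    coeff (Finsupp.single (1 : Fin 2) 1) (PowerSeries.subst (X (0 : Fin 2) : MvPowerSeries (Fin 2) k) h) = 0 := by
  rw [PowerSeries.coeff_subst (PowerSeries.HasSubst.X (0 : Fin 2)) h, finsum_eq_zero_of_forall_eq_zero]
  intro n
  rw [X_pow_eq, coeff_monomial, if_neg, smul_zero]
  intro hh
  have := congrArg (fun f => f 1) hh
  simp at this

/-- The linear part of `shift h` is unipotent. -/
theorem linMat_shift_det (h : PowerSeries k) : (FormalCoordChange.linMat (shift h)).det = 1 := by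
  rw [Matrix.det_fin_two]
  simp only [FormalCoordChange.linMat, Matrix.of_apply, shift_zero, shift_one, coeff_X, map_add,
    coeff_single_one_subst_X_zero, add_zero, Finsupp.single_eq_single_iff]
  simp

/-- The substitution family "swap the letters, then `shift h`". -/
noncomputable def shiftSwap (h : PowerSeries k) : Fin 2 → MvPowerSeries (Fin 2) k :=
  fun l => shift h (Equiv.swap (0 : Fin 2) 1 l)

/-- The linear part of `shiftSwap h` has determinant `−1`. -/
theorem linMat_shiftSwap_det (h : PowerSeries k) : (FormalCoordChange.linMat (shiftSwap h)).det = -1 := by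
  rw [Matrix.det_fin_two]
  simp only [FormalCoordChange.linMat, Matrix.of_apply, shiftSwap, Equiv.swap_apply_left, Equiv.swap_apply_right,
    shift_zero, shift_one, coeff_X, map_add, coeff_single_one_subst_X_zero, add_zero, Finsupp.single_eq_single_iff]
  simp

/-- `shift h` has zero constant terms. -/
theorem constantCoeff_shift (h : PowerSeries k) (h0 : PowerSeries.constantCoeff h = 0) (l : Fin 2) :
    constantCoeff (shift h l) = 0 :=
  (hasSubst_shift' h h0).const_coeff l |>.eq_zero

/-- `shiftSwap h` has zero constant terms. -/
theorem constantCoeff_shiftSwap (h : PowerSeries k) (h0 : PowerSeries.constantCoeff h = 0) (l : Fin 2) :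
    constantCoeff (shiftSwap h l) = 0 :=
  constantCoeff_shift h h0 _

/-- Expanding the letter swap along `h` is substituting `shiftSwap h`. -/
theorem subst_shift_swap (h : PowerSeries k) (h0 : PowerSeries.constantCoeff h = 0) (B : MvPowerSeries (Fin 2) k) :
    subst (shift h) (swap B) = subst (shiftSwap h) B := by
  have hs : HasSubst (shift h) := hasSubst_shift' h h0
  unfold swap
  rw [rename_eq_subst, subst_comp_subst_apply (HasSubst.X_comp _) hs]
  congr 1
  funext i
  rw [Function.comp_apply, subst_X hs]
  rfl

/-- The expansion along a flag of orientation `o` is the cleaning of ONE legal plane change applied to the coefficient. -/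
theorem expansion_orient_eq (p : ℕ) [Fact p.Prime] [CharP k p] (e : ℕ) (o : Bool) (h : PowerSeries k)
    (h0 : PowerSeries.constantCoeff h = 0) (A : MvPowerSeries (Fin 2) k) :
    ∃ θ : Fin 2 → MvPowerSeries (Fin 2) k, (∀ i, constantCoeff (θ i) = 0) ∧ IsUnit (FormalCoordChange.linMat θ).det ∧
      expansion (p ^ e) (orient o (cleanSeries (p ^ e) A)) h = cleanSeries (p ^ e) (subst θ A) := by
  cases o
  · refine ⟨shift h, constantCoeff_shift h h0, by rw [linMat_shift_det]; exact isUnit_one, ?_⟩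
    rw [orient_false, expansion]
    exact cleanSeries_subst_cleanSeries p e (hasSubst_shift' h h0) A
  · refine ⟨shiftSwap h, constantCoeff_shiftSwap h h0, by rw [linMat_shiftSwap_det]; exact isUnit_one.neg, ?_⟩
    rw [orient_true, expansion, ← cleanSeries_swap, cleanSeries_subst_cleanSeries p e (hasSubst_shift' h h0),
      subst_shift_swap h h0]

end PurePowerFlag

end Summit.ResolutionOfSingularities.ResolutionOfSingularities.Theorems
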